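import Summits.ResolutionOfSingularities.ResolutionOfSingularities.Theorems.EquisingularLiftEquisingularLiftNatResidueHypDefs5
import HarnessLib

/-!
# [OURS · L1 W4.5(b) · EL♮ / EL♮(3)] RESIDUE HYPOTHESIS DEFS 6 — the «HOSTED NOSE + HOSTED ROUNDS» cut's named hypotheses (WIDTH TABLE D4, row D4-1):
# `ReachHostedNoseBTriplePrime` (the stage-level hosted nose move) and `NoseHypHostedNestBTriplePrime` (ν2ʰ⁺ᴺ)

Typed by res-type-027 g20 on the W4.5b desk's DEAL D4-1 (2026-08-28T18:56:30Z, after gate G4 «S_ν(4) ∈ ν2ʰ⁺ᴺ as worded»).  THE BODY of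
`NoseHypHostedNestBTriplePrime` IS the `hres` hypothesis block of res-L1-w45b-stub-2's K5ʰ engine `target_elnat_of_hostedSubchainResolution`
(`…NatHostedSubchainPointResolution`, source sha16 5f1e8766689759f1) VERBATIM, with the engine's parameters instantiated: the initial host `E₀` bound by
`∃ E₀, (E₀ = ∅ ∨ E₀ = V₊(ℓ) for a non-zero linear form ℓ with H ⊄ V₊(ℓ)) ∧ …` (HINIT's two cases) and the stage-level hosted reach predicate `ReachH :=`
`ReachHostedNoseBTriplePrime` (7-ary: stage `F₁`, strict transform `T₁`, host `E₁`; reached stage `F₉ →β F₁`, `T₉`, new host `E₉ = ∅`).  So the rung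
(R-ν3) is ONE application of K5ʰ by name, exactly as (R-ν2) ✓ p649915 was one application of K5′.  House style R21″ (C): a successor `…NatResidueHypDefs<k>`
(p617887 / p620821 / p625534 / p628770 / p634892 / p648428 never edited); two definitions + pure-logic inclusion lemmas — no `sorry`, no instance, no notation; standard axioms.
OURS; NAMED HYPOTHESES (abbreviations of statement fragments of OUR equisingular-lift route), not statements of any manuscript; nothing of [Hironaka2017] is
asserted; AI-written, weaker than expert review; resolution of singularities in positive characteristic is NOT proved here (dimension 3 is Cossart–Piltant
2008/2009 in print).  `--kind definition --supports stmt-ResolutionOfSingularities-20148 --as helper`.  Names final on the engine owner's word.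

MEANING of `NoseHypHostedNestBTriplePrime k n H ι`: there is an initial HOST `E₀ ⊆ ℙⁿ_k` (none — `∅` —, or a hyperplane through the nose datum) such that every motive `Q F ρ T E`
holding at `(ℙⁿ, 𝟙, range ι, E₀)` and closed under (a) the HOSTED POINT STEP at a non-regular point `x` of `T̂`, regular on the ambient (and `Ẽ` regular
when `x ∈ closure E`): `(T, E) ↦ (closure υ⁻¹(T ∖ {x}), closure υ⁻¹(E ∖ {x}))`, (b) the engine's second closure clause (K5ʰ v1: the in-host NEST at
`υ⁻¹{x} ∩ St E` right after such a point step; v2: a stage-level HOSTED ROUND at a regular curve `Z ⊆ closure E ∩ T`, `T ⊄ Z`, unobstructed in `Ẽ`) — read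
the clause text below, it is the engine's —, and (c) the stage-level HOSTED NOSE MOVE `ReachHostedNoseBTriplePrime` (then the host is dropped: `E₉ = ∅`),
holds at some stage `(F', ρ', T', E')` whose reduced strict transform `T̂'` is regular.  Customer of record (gate G4): `S_ν(4)` (res-L1-w45b-nose-w4
`SNU4-CHART-TABLE.md`; word `P·N·P·N·P·N·HNOSE`, `E₀ := {w = 0}`).  The by-inclusion lemma `noseHypHostedNestBTriplePrime_of_pointsFirst`
(REPLACE prerequisite) is PURE LOGIC here thanks to the trivial host `∅` (no density lemma) and the localised, guarded host-regularity price (crit-3 (S-K5h-1), stub-2 v2.1).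
-/

set_option linter.dupNamespace false
noncomputable section
open CategoryTheory CategoryTheory.Limits AlgebraicGeometry TopologicalSpace Topology IsLocalRing
open Literature.AlgebraicGeometry.Resolution
open AlgebraicGeometry.Scheme.IdealSheafData
namespace Summit.ResolutionOfSingularities.ResolutionOfSingularities.Cruxes.EquisingularLiftNat.Sections

/-- **`ReachHostedNoseBTriplePrime F₁ T₁ E₁ F₉ β T₉ E₉`** — THE STAGE-LEVEL NOSE MOVE of K5ʰ's `ReachH` slot, two disjuncts: (FREE) `ReachPtNoseBTriplePrime`'s
data VERBATIM at stage level (closed infinite curve `Z ⊆ T₁`, `T₁ ⊄ Z`, curve clause, `Z̃` regular, ambient regular along `Z̃`, `DirStepUnobs F₁ univ _ Z hZ` —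
served by (T-k) at `⊥`, ✓ p649021), or (HOSTED) the same data with the unobstructedness RELATIVE TO THE HOST `closure E₁` (`Z ⊆ closure E₁`, `(closure E₁)~`
regular along `Z̃`, `DirStepUnobs F₁ (closure E₁) _ Z hZ` — served by (T-k) at the host's model); then the blow-up of `Z` and a B‴ chain reaching
`(F₉, β, T₉)`; the host is dropped afterwards: `E₉ = ∅` (res-L1-w45b-stub-2: the trivial host is `∅`, model `⊤`).
[OURS · L1 W4.5b · named hypothesis fragment, no mathematical content of its own] -/
def ReachHostedNoseBTriplePrime (F₁ : Scheme.{0}) (T₁ E₁ : Set F₁) (F₉ : Scheme.{0}) (β : F₉ ⟶ F₁) (T₉ E₉ : Set F₉) : Prop :=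
  E₉ = ∅ ∧
  ∃ (Z : Set F₁) (hZ : IsClosed Z),
    Z ⊆ T₁ ∧ ¬ (T₁ ⊆ Z) ∧ Z.Infinite ∧
    (∀ z : ↥(redSub F₁ Z hZ), IsClosed ({z} : Set ↥(redSub F₁ Z hZ)) → ringKrullDim ((redSub F₁ Z hZ).presheaf.stalk z) = ((1 : ℕ) : WithBot ℕ∞)) ∧
    (∀ x : redSub F₁ Z hZ, IsRegularLocalRing ((redSub F₁ Z hZ).presheaf.stalk x)) ∧
    (∀ (i : redSub F₁ Z hZ ⟶ redSub F₁ Set.univ isClosed_univ), i ≫ redSubι F₁ Set.univ isClosed_univ = redSubι F₁ Z hZ →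
      ∀ x : redSub F₁ Z hZ, IsRegularLocalRing ((redSub F₁ Set.univ isClosed_univ).presheaf.stalk (i x))) ∧
    (DirStepUnobs F₁ Set.univ isClosed_univ Z hZ ∨
      (Z ⊆ closure E₁ ∧
        (∀ (i : redSub F₁ Z hZ ⟶ redSub F₁ (closure E₁) isClosed_closure), i ≫ redSubι F₁ (closure E₁) isClosed_closure = redSubι F₁ Z hZ →
          ∀ x : redSub F₁ Z hZ, IsRegularLocalRing ((redSub F₁ (closure E₁) isClosed_closure).presheaf.stalk (i x))) ∧
        DirStepUnobs F₁ (closure E₁) isClosed_closure Z hZ)) ∧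
    ∃ (F₃ : Scheme.{0}) (υ' : F₃ ⟶ F₁), IsBlowup υ' (vanishingIdeal (⟨Z, hZ⟩ : Closeds F₁)) ∧
      ∃ (γ' : F₉ ⟶ F₃) (E' : Set F₉) (Es' Ns' : List (Set F₉)) (K' : Set F₉),
        (∀ R : (∀ G : Scheme.{0}, (G ⟶ F₃) → Set G → Set G → List (Set G) → List (Set G) → Set G → Prop),
          R F₃ (𝟙 F₃) (closure (υ' ⁻¹' (T₁ \ Z))) (υ' ⁻¹' Z) [] [] ∅ →
          TowerPtRegB₄ F₃ R → TowerPtRamB₄ F₃ R → TowerRoundBTriplePrime F₁ F₃ υ' Z hZ R →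
          R F₉ γ' T₉ E' Es' Ns' K') ∧
        β = γ' ≫ υ'

/-- The FREE nose move of (H-ν2) is the first disjunct: `ReachPtNoseBTriplePrime F₀ F₁ υ x T₁ F₉ β T₉ → ReachHostedNoseBTriplePrime F₁ T₁ E₁ F₉ β T₉ ∅`
for every host `E₁` (the point-step binders of `ReachPtNoseBTriplePrime` are unreferenced). [OURS · pure logic] -/
theorem reachHostedNoseBTriplePrime_of_reachPtNose {F₀ F₁ : Scheme.{0}} (υ : F₁ ⟶ F₀) (x : F₀) (T₁ E₁ : Set F₁) (F₉ : Scheme.{0}) (β : F₉ ⟶ F₁)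
    (T₉ : Set F₉) (h : ReachPtNoseBTriplePrime F₀ F₁ υ x T₁ F₉ β T₉) : ReachHostedNoseBTriplePrime F₁ T₁ E₁ F₉ β T₉ ∅ := by
  obtain ⟨Z, hZ, h1, h2, h3, h4, h5, h6, h7, htail⟩ := h
  exact ⟨rfl, Z, hZ, h1, h2, h3, h4, h5, h6, Or.inl h7, htail⟩

/-- **`NoseHypHostedNestBTriplePrime k n H ι`** (ν2ʰ⁺ᴺ) — the K5ʰ engine's `hres` hypothesis VERBATIM (source sha16 5f1e8766689759f1) with `E₀` bound
(`∅` or a hyperplane `V₊(ℓ)` not containing `H`) and `ReachH := ReachHostedNoseBTriplePrime`.  See the module docstring for the reading.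
[OURS · L1 W4.5b · named hypothesis, no mathematical content of its own] -/
def NoseHypHostedNestBTriplePrime (k : Type) [Field k] [IsAlgClosed k] (n : ℕ) (H : AlgebraicGeometry.Scheme.{0})
    (ι : H ⟶ (Literature.AlgebraicGeometry.Motives.projectiveSpace n k).left) : Prop :=
  letI := MvPolynomial.gradedAlgebra (σ := Fin (n + 1)) (R := k)
  ∃ (E₀ : Set (Literature.AlgebraicGeometry.Motives.projectiveSpace n k).left),
    (E₀ = ∅ ∨ ∃ ℓ : MvPolynomial (Fin (n + 1)) k, ℓ.IsHomogeneous 1 ∧ ℓ ≠ 0 ∧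
      ¬ (Set.range ι ⊆ {y : (Literature.AlgebraicGeometry.Motives.projectiveSpace n k).left |
        ℓ ∈ (y : ProjectiveSpectrum (MvPolynomial.homogeneousSubmodule (Fin (n + 1)) k)).asHomogeneousIdeal}) ∧
      E₀ = {y : (Literature.AlgebraicGeometry.Motives.projectiveSpace n k).left |
        ℓ ∈ (y : ProjectiveSpectrum (MvPolynomial.homogeneousSubmodule (Fin (n + 1)) k)).asHomogeneousIdeal}) ∧
    (∃ (F' : AlgebraicGeometry.Scheme.{0}) (ρ' : F' ⟶ (Literature.AlgebraicGeometry.Motives.projectiveSpace n k).left) (T' : Set F'),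
      (∀ Q : (∀ F₁ : AlgebraicGeometry.Scheme.{0}, (F₁ ⟶ (Literature.AlgebraicGeometry.Motives.projectiveSpace n k).left) → Set F₁ → Set F₁ → Prop),
        Q (Literature.AlgebraicGeometry.Motives.projectiveSpace n k).left (𝟙 (Literature.AlgebraicGeometry.Motives.projectiveSpace n k).left) (Set.range ι) E₀ →
        (∀ (F₁ F₂ : AlgebraicGeometry.Scheme.{0}) (ρ : F₁ ⟶ (Literature.AlgebraicGeometry.Motives.projectiveSpace n k).left) (T₁ E₁ : Set F₁)
            (x : ↥((AlgebraicGeometry.Scheme.IdealSheafData.vanishingIdeal (⟨closure T₁, isClosed_closure⟩ : TopologicalSpace.Closeds F₁))).subscheme) (υ : F₂ ⟶ F₁) (hx : IsClosed ({(((AlgebraicGeometry.Scheme.IdealSheafData.vanishingIdeal (⟨closure T₁, isClosed_closure⟩ : TopologicalSpace.Closeds F₁))).subschemeι x : F₁)} : Set F₁)),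
          Q F₁ ρ T₁ E₁ → ¬ IsRegularLocalRing (((AlgebraicGeometry.Scheme.IdealSheafData.vanishingIdeal (⟨closure T₁, isClosed_closure⟩ : TopologicalSpace.Closeds F₁))).subscheme.presheaf.stalk x) →
          IsRegularLocalRing (F₁.presheaf.stalk (((AlgebraicGeometry.Scheme.IdealSheafData.vanishingIdeal (⟨closure T₁, isClosed_closure⟩ : TopologicalSpace.Closeds F₁))).subschemeι x : F₁)) →
          ((((AlgebraicGeometry.Scheme.IdealSheafData.vanishingIdeal (⟨closure T₁, isClosed_closure⟩ : TopologicalSpace.Closeds F₁))).subschemeι x : F₁) ∈ closure E₁ → ∀ e : ↥(redSub F₁ (closure E₁) isClosed_closure), (redSubι F₁ (closure E₁) isClosed_closure e : F₁) = (((AlgebraicGeometry.Scheme.IdealSheafData.vanishingIdeal (⟨closure T₁, isClosed_closure⟩ : TopologicalSpace.Closeds F₁))).subschemeι x : F₁) →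
          IsRegularLocalRing ((redSub F₁ (closure E₁) isClosed_closure).presheaf.stalk e)) → Literature.AlgebraicGeometry.Resolution.IsBlowup υ
            (AlgebraicGeometry.Scheme.IdealSheafData.vanishingIdeal (⟨{(((AlgebraicGeometry.Scheme.IdealSheafData.vanishingIdeal (⟨closure T₁, isClosed_closure⟩ : TopologicalSpace.Closeds F₁))).subschemeι x : F₁)}, hx⟩ : TopologicalSpace.Closeds F₁)) →
          Q F₂ (υ ≫ ρ) (closure (υ ⁻¹' (T₁ \ {(((AlgebraicGeometry.Scheme.IdealSheafData.vanishingIdeal (⟨closure T₁, isClosed_closure⟩ : TopologicalSpace.Closeds F₁))).subschemeι x : F₁)}))) (closure (υ ⁻¹' (E₁ \ {(((AlgebraicGeometry.Scheme.IdealSheafData.vanishingIdeal (⟨closure T₁, isClosed_closure⟩ : TopologicalSpace.Closeds F₁))).subschemeι x : F₁)})))) →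
        -- STAGE-LEVEL HOSTED ROUND at a regular curve `Z` inside the host, unobstructed IN THE HOST (in-host NEST lines and the nose curve alike)
        (∀ (F₁ F₃ : AlgebraicGeometry.Scheme.{0}) (ρ : F₁ ⟶ (Literature.AlgebraicGeometry.Motives.projectiveSpace n k).left) (T₁ E₁ : Set F₁) (Z : Set F₁) (hZ : IsClosed Z) (υ' : F₃ ⟶ F₁),
          Q F₁ ρ T₁ E₁ → Z ⊆ closure E₁ → Z ⊆ T₁ → ¬ T₁ ⊆ Z → (∀ z : ↥(redSub F₁ Z hZ), IsRegularLocalRing ((redSub F₁ Z hZ).presheaf.stalk z)) →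
          (∀ (i : redSub F₁ Z hZ ⟶ redSub F₁ (closure E₁) isClosed_closure), i ≫ redSubι F₁ (closure E₁) isClosed_closure = redSubι F₁ Z hZ →
            ∀ z : ↥(redSub F₁ Z hZ), IsRegularLocalRing ((redSub F₁ (closure E₁) isClosed_closure).presheaf.stalk (i z))) → DirStepUnobs F₁ (closure E₁) isClosed_closure Z hZ →
          Literature.AlgebraicGeometry.Resolution.IsBlowup υ' (AlgebraicGeometry.Scheme.IdealSheafData.vanishingIdeal (⟨Z, hZ⟩ : TopologicalSpace.Closeds F₁)) →
          Q F₃ (υ' ≫ ρ) (closure (υ' ⁻¹' (T₁ \ Z))) (closure (υ' ⁻¹' (closure E₁ \ Z)))) →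
        (∀ (F₁ : AlgebraicGeometry.Scheme.{0}) (ρ : F₁ ⟶ (Literature.AlgebraicGeometry.Motives.projectiveSpace n k).left) (T₁ E₁ : Set F₁) (F₉ : AlgebraicGeometry.Scheme.{0}) (β : F₉ ⟶ F₁) (T₉ E₉ : Set F₉),
          Q F₁ ρ T₁ E₁ → ReachHostedNoseBTriplePrime F₁ T₁ E₁ F₉ β T₉ E₉ → Q F₉ (β ≫ ρ) T₉ E₉) → ∃ E' : Set F', Q F' ρ' T' E') ∧
      Literature.AlgebraicGeometry.Resolution.Scheme.IsRegular (AlgebraicGeometry.Scheme.IdealSheafData.vanishingIdeal (⟨closure T', isClosed_closure⟩ : TopologicalSpace.Closeds F')).subscheme)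

/-- **BY INCLUSION** (the lemma the REPLACE cut `¬ NoseHypPointsFirstBTriplePrime ↦ ¬ NoseHypHostedNestBTriplePrime` needs): the unhosted points-first
nose hypothesis (H-ν2) implies the hosted one — initial host `E₀ := ∅`; run the hosted motive through (H-ν2)'s closure as `Q₂ F ρ T := Q F ρ T ∅`:
the hosted point step at host `∅` is (H-ν2)'s point step (its host-regularity price is guarded by `ι x ∈ closure ∅`, vacuous, and `closure υ⁻¹(∅ ∖ {x}) = ∅`),
the free nose is `ReachHostedNoseBTriplePrime`'s first disjunct (`reachHostedNoseBTriplePrime_of_reachPtNose`); the hosted ROUND clause is not used.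
[OURS · pure logic] -/
theorem noseHypHostedNestBTriplePrime_of_pointsFirst (k : Type) [Field k] [IsAlgClosed k] (n : ℕ) (H : AlgebraicGeometry.Scheme.{0})
    (ι : H ⟶ (Literature.AlgebraicGeometry.Motives.projectiveSpace n k).left) (h : NoseHypPointsFirstBTriplePrime k n H ι) :
    NoseHypHostedNestBTriplePrime k n H ι := by
  obtain ⟨F', ρ', T', hQ, hreg⟩ := h
  refine ⟨∅, Or.inl rfl, F', ρ', T', fun Q hQ0 hpt _ hreach => ⟨∅, ?_⟩, hreg⟩
  refine hQ (fun F ρ T => Q F ρ T ∅) hQ0 ?_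
  intro F₁ F₂ ρ T₁ x υ hx hQ1 hnreg hreg1 hυ
  have hst : closure (υ ⁻¹' ((∅ : Set F₁) \
      {((AlgebraicGeometry.Scheme.IdealSheafData.vanishingIdeal (⟨closure T₁, isClosed_closure⟩ : TopologicalSpace.Closeds F₁)).subschemeι x : F₁)})) =
      (∅ : Set F₂) := by
    rw [Set.empty_sdiff, Set.preimage_empty, closure_empty]
  have hpt' := hpt F₁ F₂ ρ T₁ ∅ x υ hx hQ1 hnreg hreg1 (fun hmem => absurd hmem (by rw [closure_empty]; exact Set.notMem_empty _)) hυ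
  rw [hst] at hpt'
  refine ⟨hpt', fun F₉ β T₉ hR => ?_⟩
  have h9 := hreach F₂ (υ ≫ ρ) _ ∅ F₉ β T₉ ∅ hpt' (reachHostedNoseBTriplePrime_of_reachPtNose υ _ _ ∅ F₉ β T₉ hR)
  simpa only [Category.assoc] using h9

/-- Contrapositive form, as the REPLACE cut consumes it: the new residue hypothesis `¬ NoseHypHostedNestBTriplePrime` implies the old one
`¬ NoseHypPointsFirstBTriplePrime`. [OURS · pure logic] -/
theorem not_noseHypPointsFirstBTriplePrime_of_not_hostedNest (k : Type) [Field k] [IsAlgClosed k] (n : ℕ) (H : AlgebraicGeometry.Scheme.{0})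
    (ι : H ⟶ (Literature.AlgebraicGeometry.Motives.projectiveSpace n k).left) (h : ¬ NoseHypHostedNestBTriplePrime k n H ι) :
    ¬ NoseHypPointsFirstBTriplePrime k n H ι :=
  fun h' => h (noseHypHostedNestBTriplePrime_of_pointsFirst k n H ι h')

end Summit.ResolutionOfSingularities.ResolutionOfSingularities.Cruxes.EquisingularLiftNat.Sections

end
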